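import Mathlib
import HarnessLib
import Summits.HubbardSuperconductivity.HubbardSuperconductivity.Theorems.KLProgrammeLatticeSoftBubble
import Summits.HubbardSuperconductivity.HubbardSuperconductivity.Theorems.KLProgrammeKLRegimeEnginePairTransferDLineSupport

/-!
# Route `KLProgramme` — ENGINE item stmt-HubbardSuperconductivity-20437 `KLRegimeEngineV17F2`, class-#5 STEP (X).3 rows form / (c) `hout` rows:
# THE SIGNED SOFT FORWARD BUBBLE ON THE MODEL'S OWN BAND — `klfl_lattice_soft_bubble_norm_le` with the frame band `e_K`, the shifted band
# `e_K(· + p_q̃)` and the frame data of an ADMISSIBLE frame (`FrameOK`) supplied internally (cell gate-hubbard-kl, seat hubbard-kl-k3c2-p2 g17)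

WHY.  The signed lattice ph-loop rows of this lineage read two abstract planar bands `eb`, `eb'` (periodic, continuous, Lipschitz, `eb = klfb_band δ μ`
on the zone, `|eb' − eb| ≤ δ_max`) and a zone margin.  On the model every consumer has the SAME instance: `eb = E_K` (the planar chart of the frame band,
`E_K(p_k̃) = e_K(k̃) = nambuXiCT L μ K k̃`) and `eb' = E_K(· + v)` with `v` the representative of the lattice transfer `p_q̃` nearest to `0`
(`E_K(p_k̃ + v) = e_K(k̃ + q̃)`, `|E_K(· + v) − E_K| ≤ G·|p_q̃|_𝕋`, `G = 4 + (8/3)·Gfr₁·U²`).  This file builds that instance once: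

* §1 `klbandPl μ K` (= `klfb_band δ_K μ`, `δ_K = frameShift K ∘ toLp`): planar form, periodicity, continuity, `G`-Lipschitz under `FrameOK`, lattice values;
* §2 `klrepr L q̃` (nearest representative, `‖·‖_∞ = klTorusNorm L q̃`) and the shifted band `klbandShift μ K v`: periodicity, continuity, Lipschitz, the shift
  bound, lattice values `= e_K(k̃ + q̃)`;
* §3 the ZONE MARGIN `zm = 1/10`: for `μ ≤ −0.15`, `|K| ≤ 1/20` on the zone and `1 ≤ n`, `|E_K(p)| < 4Λ_n ⟹ |p_i| ≤ π − 1/5` (`klbandPl_zone`);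
* §4 **`klfl_lattice_soft_bubble_norm_le_model`** — the signed soft forward row ON THE MODEL: for a frame with `‖D^jδ_K‖ ≤ A` (`j ≤ 2`; e.g.
  `klrk_frame_C2_bound` in the KL regime), `4A < Dt_min`, the margin window, a planar vertex weight `a` (`A₀`, `L_a`), abstract line weights `f, f'` at the
  scale index `n` (the STEP's `klWdC`/`klPhiC`, `…EngineFlowSliceWeights`), a lattice transfer `q̃` with `G·klTorusNorm L q̃ ≤ Λ_n/8` and a frequency
  transfer `|q₀| ≤ Λ_n/8`:  `‖β⁻¹•Σ_i L⁻²•Σ_k̃ a(p_k̃)·Φ_f(ω_i, e_K(k̃))·Φ_{f'}(ω_i + q₀, e_K(k̃ + q̃))‖ ≤ ZS·Λ_n + thermal·(π/β)/Λ_n + transfer·(|q₀| + G|p_q̃|_𝕋)/Λ_n + lattice/L`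
  (all frame data enter through `d = Dt_min − 4A` and `G`); **`…_model_regime`**: the same keyed on `FrameOK R U (nScales β) μ K` in the KL regime.

Pure analysis + dictionary; nothing about the model's effective action is asserted; nothing asserts (X).3, (c), K3 or superconductivity.
References: BGM 2006 §2.4–2.5 [cite: BenfattoGiulianiMastropietro2006]; FST 1998 App. B [cite: FeldmanSalmhoferTrubowitz1998].
-/

noncomputable section

namespace Summit.HubbardSuperconductivity.HubbardSuperconductivity.Theorems.KLRegimeSplit

set_option linter.dupNamespace false -- summit = problem name (single-conjunct summit), D-0017

open Real Set MeasureTheory Complex Literature.MathematicalPhysics.QuantumLattice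
open Literature.Probability.LatticeModels hiding torusSupNorm
open Literature.MathematicalPhysics.QuantumLattice.BandSectorCounting
open Summit.HubbardSuperconductivity.HubbardSuperconductivity.Theorems.PerturbedFermiCurve
open Summit.HubbardSuperconductivity.HubbardSuperconductivity.Theorems.KLProgrammeLegKernels
open Summit.HubbardSuperconductivity.HubbardSuperconductivity.Theorems.DispersionFlow
open Summit.HubbardSuperconductivity.HubbardSuperconductivity.Theorems.TwoPointAssembly
open Summit.HubbardSuperconductivity.HubbardSuperconductivity.Theorems.EngineV8
open scoped NNReal

/-! ## §1 The planar chart of the frame band -/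

/-- **`klbandPl μ K`** — the planar chart `E_K(p) = ε(p⃗) − K(p⃗) − μ` of the frame band (`= klfb_band δ_K μ`, `δ_K = frameShift K ∘ toLp`). -/
def klbandPl (μ : ℝ) (K : TrigPolyC4v) : ℝ × ℝ → ℝ := klfb_band (fun k : Fin 2 → ℝ => frameShift K (WithLp.toLp 2 k)) μ

/-- Planar form: `E_K(p) = ε ![p₁,p₂] + (−K ![p₁,p₂]) − μ`. -/
theorem klbandPl_eq_planar (μ : ℝ) (K : TrigPolyC4v) (p : ℝ × ℝ) :
    klbandPl μ K p = sqDispersion ![p.1, p.2] + -K.eval ![p.1, p.2] - μ := by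
  simp only [klbandPl, klfb_band, frameShift_toLp]

/-- `E_K` IS `klfb_band δ_K μ` (so the rows' `heb` hypothesis is an identity on the whole plane). -/
theorem klbandPl_eq_klfb_band (μ : ℝ) (K : TrigPolyC4v) (p : ℝ × ℝ) :
    klbandPl μ K p = klfb_band (fun k : Fin 2 → ℝ => frameShift K (WithLp.toLp 2 k)) μ p := rfl

/-- Periodicity under an integer vector of `2π`'s. -/
theorem klbandPl_add_int_vec (μ : ℝ) (K : TrigPolyC4v) (p : ℝ × ℝ) (z : Fin 2 → ℤ) :
    klbandPl μ K (p.1 + 2 * π * (z 0 : ℝ), p.2 + 2 * π * (z 1 : ℝ)) = klbandPl μ K p := by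
  rw [klbandPl_eq_planar, klbandPl_eq_planar]
  have e : (![p.1 + 2 * π * (z 0 : ℝ), p.2 + 2 * π * (z 1 : ℝ)] : Fin 2 → ℝ) = fun i => (![p.1, p.2] : Fin 2 → ℝ) i + 2 * π * (z i : ℝ) := by
    funext i; fin_cases i <;> simp
  rw [e, planarBand_periodic]

/-- `E_K(x + 2π, y) = E_K(x, y)`. -/
theorem klbandPl_periodic₁ (μ : ℝ) (K : TrigPolyC4v) (x y : ℝ) : klbandPl μ K (x + 2 * π, y) = klbandPl μ K (x, y) := by
  simpa using klbandPl_add_int_vec μ K (x, y) ![1, 0]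

/-- `E_K(x, y + 2π) = E_K(x, y)`. -/
theorem klbandPl_periodic₂ (μ : ℝ) (K : TrigPolyC4v) (x y : ℝ) : klbandPl μ K (x, y + 2 * π) = klbandPl μ K (x, y) := by
  simpa using klbandPl_add_int_vec μ K (x, y) ![0, 1]

/-- Continuity of `E_K`. -/
theorem continuous_klbandPl (μ : ℝ) (K : TrigPolyC4v) : Continuous (klbandPl μ K) :=
  klfb_continuous_band (continuous_frameShift_toLp K) μ

/-- **`G`-Lipschitz in the sup metric** for an admissible frame: `|E_K(p) − E_K(q)| ≤ (4 + (8/3)·Gfr₁·U²)·dist p q`. -/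
theorem klbandPl_lipschitz {R : RenConsts} (hR : ∀ j, 0 ≤ R.Gfr j) {U : ℝ} {N : ℕ} {μ : ℝ} {K : TrigPolyC4v} (hK : FrameOK R U N μ K) (p q : ℝ × ℝ) :
    |klbandPl μ K p - klbandPl μ K q| ≤ (4 + 8 / 3 * R.Gfr 1 * U ^ 2) * dist p q := by
  rw [klbandPl_eq_planar, klbandPl_eq_planar]
  have hκ : ∀ k : Fin 2 → ℝ, (∀ i, |k i| ≤ π) → ‖fderiv ℝ (fun k : Fin 2 → ℝ => -K.eval k) k‖ ≤ 8 / 3 * R.Gfr 1 * U ^ 2 :=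
    fun k _ => norm_fderiv_negEval_le_of_frameOK hR hK k
  have h := abs_frameE_sub_le hκ ![p.1, p.2] ![q.1, q.2]
  rw [norm_vec_sub_vec_eq_dist] at h
  have e : (sqDispersion ![p.1, p.2] + -K.eval ![p.1, p.2] - μ) - (sqDispersion ![q.1, q.2] + -K.eval ![q.1, q.2] - μ) =
      (sqDispersion ![p.1, p.2] + -K.eval ![p.1, p.2]) - (sqDispersion ![q.1, q.2] + -K.eval ![q.1, q.2]) := by ring
  rw [e]; exact h

/-- **Lattice values**: `E_K(p_k̃ 0, p_k̃ 1) = e_K(k̃)`. -/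
theorem klbandPl_latticeMomentum {L : ℕ} [NeZero L] (μ : ℝ) (K : TrigPolyC4v) (k : TorusSite 2 L) :
    klbandPl μ K (latticeMomentum L k 0, latticeMomentum L k 1) = nambuXiCT L μ K k := by
  rw [klbandPl_eq_planar, nambuXiCT_eq_planarBand]

/-! ## §2 The nearest representative of a lattice transfer and the shifted band -/

/-- The representative of `p_q̃` in `(−π, π]²`. -/
def klrepr (L : ℕ) (q : TorusSite 2 L) : ℝ × ℝ :=
  (toIocMod Real.two_pi_pos (-π) (latticeMomentum L q 0), toIocMod Real.two_pi_pos (-π) (latticeMomentum L q 1))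

/-- `‖klrepr L q̃‖_∞ = klTorusNorm L q̃`: `max |v₁| |v₂| = |p_q̃|_𝕋`. -/
theorem norm_klrepr_eq {L : ℕ} (q : TorusSite 2 L) : max |(klrepr L q).1| |(klrepr L q).2| = klTorusNorm L q := rfl

/-- `p_q̃ = klrepr L q̃ + 2π·(integer vector)`. -/
theorem latticeMomentum_eq_klrepr_add {L : ℕ} (q : TorusSite 2 L) :
    ∃ z : Fin 2 → ℤ, latticeMomentum L q 0 = (klrepr L q).1 + 2 * π * (z 0 : ℝ) ∧ latticeMomentum L q 1 = (klrepr L q).2 + 2 * π * (z 1 : ℝ) := by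
  refine ⟨![toIocDiv Real.two_pi_pos (-π) (latticeMomentum L q 0), toIocDiv Real.two_pi_pos (-π) (latticeMomentum L q 1)], ?_, ?_⟩
  · have h := toIocMod_add_toIocDiv_zsmul Real.two_pi_pos (-π) (latticeMomentum L q 0)
    rw [zsmul_eq_mul] at h; simp [klrepr]; linarith
  · have h := toIocMod_add_toIocDiv_zsmul Real.two_pi_pos (-π) (latticeMomentum L q 1)
    rw [zsmul_eq_mul] at h; simp [klrepr]; linarith

/-- **`klbandShift μ K v`** — the band shifted by a planar vector: `p ↦ E_K(p + v)`. -/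
def klbandShift (μ : ℝ) (K : TrigPolyC4v) (v : ℝ × ℝ) : ℝ × ℝ → ℝ := fun p => klbandPl μ K (p + v)

/-- Periodicity of the shifted band (first coordinate). -/
theorem klbandShift_periodic₁ (μ : ℝ) (K : TrigPolyC4v) (v : ℝ × ℝ) (x y : ℝ) : klbandShift μ K v (x + 2 * π, y) = klbandShift μ K v (x, y) := by
  unfold klbandShift
  rw [show ((x + 2 * π, y) : ℝ × ℝ) + v = ((x + v.1) + 2 * π, y + v.2) by ext <;> simp [add_right_comm],
    show ((x, y) : ℝ × ℝ) + v = (x + v.1, y + v.2) by rfl, klbandPl_periodic₁]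

/-- Periodicity of the shifted band (second coordinate). -/
theorem klbandShift_periodic₂ (μ : ℝ) (K : TrigPolyC4v) (v : ℝ × ℝ) (x y : ℝ) : klbandShift μ K v (x, y + 2 * π) = klbandShift μ K v (x, y) := by
  unfold klbandShift
  rw [show ((x, y + 2 * π) : ℝ × ℝ) + v = (x + v.1, (y + v.2) + 2 * π) by ext <;> simp [add_right_comm],
    show ((x, y) : ℝ × ℝ) + v = (x + v.1, y + v.2) by rfl, klbandPl_periodic₂]

/-- Continuity of the shifted band. -/
theorem continuous_klbandShift (μ : ℝ) (K : TrigPolyC4v) (v : ℝ × ℝ) : Continuous (klbandShift μ K v) :=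
  (continuous_klbandPl μ K).comp (continuous_id.add continuous_const)

/-- The shifted band is `G`-Lipschitz. -/
theorem klbandShift_lipschitz {R : RenConsts} (hR : ∀ j, 0 ≤ R.Gfr j) {U : ℝ} {N : ℕ} {μ : ℝ} {K : TrigPolyC4v} (hK : FrameOK R U N μ K)
    (v p q : ℝ × ℝ) : |klbandShift μ K v p - klbandShift μ K v q| ≤ (4 + 8 / 3 * R.Gfr 1 * U ^ 2) * dist p q := by
  unfold klbandShift
  have h := klbandPl_lipschitz hR hK (p + v) (q + v)
  rwa [dist_add_right] at h

/-- **The shift bound**: `|E_K(p + v) − E_K(p)| ≤ G·max |v₁| |v₂|`. -/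
theorem abs_klbandShift_sub_le {R : RenConsts} (hR : ∀ j, 0 ≤ R.Gfr j) {U : ℝ} {N : ℕ} {μ : ℝ} {K : TrigPolyC4v} (hK : FrameOK R U N μ K)
    (v p : ℝ × ℝ) : |klbandShift μ K v p - klbandPl μ K p| ≤ (4 + 8 / 3 * R.Gfr 1 * U ^ 2) * max |v.1| |v.2| := by
  unfold klbandShift
  have h := klbandPl_lipschitz hR hK (p + v) p
  have hd : dist (p + v) p = max |v.1| |v.2| := by
    rw [Prod.dist_eq, Real.dist_eq, Real.dist_eq]; simp
  rwa [hd] at h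

/-- **Lattice values of the shifted band**: `E_K(p_k̃ + klrepr q̃) = e_K(k̃ + q̃)`. -/
theorem klbandShift_repr_latticeMomentum {L : ℕ} [NeZero L] (μ : ℝ) (K : TrigPolyC4v) (k q : TorusSite 2 L) :
    klbandShift μ K (klrepr L q) (latticeMomentum L k 0, latticeMomentum L k 1) = nambuXiCT L μ K (k + q) := by
  unfold klbandShift
  obtain ⟨z, hz0, hz1⟩ := latticeMomentum_eq_klrepr_add q
  obtain ⟨z₁, hz₁⟩ := latticeMomentum_sub_eq (k + q) q
  simp only [add_sub_cancel_right] at hz₁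
  -- `p_{k+q} = (p_k + v) + 2π·(z₁ − z)`
  have h0 : latticeMomentum L (k + q) 0 = (latticeMomentum L k 0 + (klrepr L q).1) + 2 * π * ((z 0 - z₁ 0 : ℤ) : ℝ) := by
    have := congrFun hz₁ 0; push_cast; linarith
  have h1 : latticeMomentum L (k + q) 1 = (latticeMomentum L k 1 + (klrepr L q).2) + 2 * π * ((z 1 - z₁ 1 : ℤ) : ℝ) := by
    have := congrFun hz₁ 1; push_cast; linarith
  rw [← klbandPl_latticeMomentum, h0, h1]
  have e := klbandPl_add_int_vec μ K ((latticeMomentum L k 0, latticeMomentum L k 1) + klrepr L q) ![z 0 - z₁ 0, z 1 - z₁ 1]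
  simp only [Prod.fst_add, Prod.snd_add, Matrix.cons_val_zero, Matrix.cons_val_one] at e
  exact e.symm

/-! ## §3 The zone margin `zm = 1/10` -/

/-- `cos x ≤ −0.98` for `π − 1/5 ≤ |x| ≤ π`. -/
theorem klbd_cos_le_of_near_pi {x : ℝ} (hx : π - 1 / 5 ≤ |x|) (hxπ : |x| ≤ π) : Real.cos x ≤ -(49 / 50) := by
  rw [← Real.cos_abs]
  have h1 : Real.cos |x| ≤ Real.cos (π - 1 / 5) :=
    Real.cos_le_cos_of_nonneg_of_le_pi (by linarith [Real.pi_gt_three]) hxπ hx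
  have h2 : Real.cos (π - 1 / 5) = -Real.cos (1 / 5) := Real.cos_pi_sub _
  have h3 : 1 - (1 / 5 : ℝ) ^ 2 / 2 ≤ Real.cos (1 / 5) := Real.one_sub_sq_div_two_le_cos
  linarith

/-- **THE ZONE MARGIN**: for `μ ≤ −0.15`, a frame with `|K(p⃗)| ≤ 1/20` on the plane and a scale index `1 ≤ n`, a point of the zone with
`|E_K(p)| < 4Λ_n` satisfies `|p₁| ≤ π − 2·(1/10)` and `|p₂| ≤ π − 2·(1/10)`. -/
theorem klbandPl_zone {μ : ℝ} (hμ : μ ≤ -0.15) {K : TrigPolyC4v} (hKb : ∀ k : Fin 2 → ℝ, |K.eval k| ≤ 1 / 20) {n : ℕ} (hn : 1 ≤ n)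
    (p : ℝ × ℝ) (hp : p ∈ Icc (-π) π ×ˢ Icc (-π) π) (he : |klbandPl μ K p| < 4 * klScale klE0 n) :
    |p.1| ≤ π - 2 * (1 / 10) ∧ |p.2| ≤ π - 2 * (1 / 10) := by
  have hΛ : 4 * klScale klE0 n ≤ 1 / 32 := by
    have h1 : klScale klE0 n ≤ klScale klE0 1 := by
      unfold klScale; exact mul_le_mul_of_nonneg_left (inv_anti₀ (by positivity) (pow_le_pow_right₀ (by norm_num) hn)) (by unfold klE0; norm_num)
    have h2 : klScale klE0 1 = 1 / 128 := by unfold klScale klE0; norm_num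
    linarith
  obtain ⟨⟨h1l, h1u⟩, ⟨h2l, h2u⟩⟩ := hp
  have hp1 : |p.1| ≤ π := abs_le.2 ⟨h1l, h1u⟩
  have hp2 : |p.2| ≤ π := abs_le.2 ⟨h2l, h2u⟩
  have hc1 : Real.cos p.1 ≤ 1 := Real.cos_le_one _
  have hc2 : Real.cos p.2 ≤ 1 := Real.cos_le_one _
  have hKp := hKb ![p.1, p.2]
  rw [abs_le] at hKp
  rw [klbandPl_eq_planar] at he
  have he' := (abs_lt.1 he).2
  simp only [sqDispersion, Matrix.cons_val_zero, Matrix.cons_val_one] at he'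
  by_contra hcon
  rw [not_and_or, not_le, not_le] at hcon
  rcases hcon with h | h
  · have hcos := klbd_cos_le_of_near_pi (by linarith) hp1
    linarith
  · have hcos := klbd_cos_le_of_near_pi (by linarith) hp2
    linarith

/-- The frame bound on the plane in the form `|K(p⃗)| ≤ 4A` from the `C²` size `A` of `frameShift K`. -/
theorem abs_eval_le_of_C2 {K : TrigPolyC4v} {A : ℝ} (hAb : ∀ p : Momentum, ∀ j ≤ 2, ‖iteratedFDeriv ℝ j (frameShift K) p‖ ≤ A) (k : Fin 2 → ℝ) :
    |K.eval k| ≤ 4 * A := by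
  have h := (frameShift_toLp_small hAb le_rfl).1 k
  rwa [frameShift_toLp, abs_neg] at h

/-! ## §4 The signed soft forward bubble on the model band -/

section Model

variable {a' b' : ℝ} (B : BandBounds a' b') {R : RenConsts} {U μ : ℝ} {N : ℕ} {K : TrigPolyC4v} {A : ℝ}

/-- **THE SIGNED SOFT FORWARD BUBBLE ON THE MODEL BAND** (see the module docstring): `klfl_lattice_soft_bubble_norm_le` at `eb = E_K`, `eb' = E_K(· + klrepr q̃)`,
`δ = δ_K`, `κ₀ = κ₁ = κ₂ = 4A`, `L_e = L_e' = G = 4 + (8/3)Gfr₁U²`, `δ_max = G·klTorusNorm L q̃`, `zm = 1/10`. -/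
theorem klfl_lattice_soft_bubble_norm_le_model (hR : ∀ j, 0 ≤ R.Gfr j) (hK : FrameOK R U N μ K)
    (hAb : ∀ p : Momentum, ∀ j ≤ 2, ‖iteratedFDeriv ℝ j (frameShift K) p‖ ≤ A) (hA : 4 * A < B.Dtmin) (hA20 : 4 * A ≤ 1 / 20) (hμ : μ ≤ -0.15)
    {a : ℝ × ℝ → ℂ} (ha : Continuous a) (ha1 : ∀ x y, a (x + 2 * π, y) = a (x, y)) (ha2 : ∀ x y, a (x, y + 2 * π) = a (x, y))
    {A₀ La : ℝ} (hA0 : ∀ p, ‖a p‖ ≤ A₀) (hLa : ∀ p q, ‖a p - a q‖ ≤ La * dist p q)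
    {n : ℕ} (hn1 : 1 ≤ n) {L : ℕ} [NeZero L] (q : TorusSite 2 L)
    (hq : (4 + 8 / 3 * R.Gfr 1 * U ^ 2) * klTorusNorm L q ≤ klScale klE0 n / 8)
    {f f' : ℝ → ℂ} {Lf Mf ℓf Lf' Mf' ℓ' LF MF ℓ : ℝ}
    (hlip : ∀ s s', ‖f s - f s'‖ ≤ Lf * |s - s'|) (hbd : ∀ s, ‖f s‖ ≤ Mf) (hLf : Lf ≤ ℓf / klScale klE0 n ^ 2)
    (hin : ∀ s, s ≤ (klScale klE0 n / 2) ^ 2 → f s = 0) (hout : ∀ s, (4 * klScale klE0 n) ^ 2 ≤ s → f s = 0)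
    (hlip' : ∀ s s', ‖f' s - f' s'‖ ≤ Lf' * |s - s'|) (hbd' : ∀ s, ‖f' s‖ ≤ Mf') (hLf' : Lf' ≤ ℓ' / klScale klE0 n ^ 2)
    (hout' : ∀ s, (4 * klScale klE0 n) ^ 2 ≤ s → f' s = 0)
    (hMF : 0 ≤ MF) (hFlip : ∀ s s', ‖f s * f' s - f s' * f' s'‖ ≤ LF * |s - s'|) (hFbd : ∀ s, ‖f s * f' s‖ ≤ MF)
    (hLF : LF ≤ ℓ / klScale klE0 n ^ 2)
    (hlo : a' < μ - 4 * klScale klE0 n - 4 * A) (hhi : μ + 4 * klScale klE0 n + 4 * A < b')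
    {q₀ : ℝ} (hq₀ : |q₀| ≤ klScale klE0 n / 8) {β : ℝ} (hβ : klBetaMin ≤ β) (hn : n ≤ nScales β + 1) {M : ℕ}
    (hM : β * (4 * klScale klE0 n) / (2 * Real.pi) + 1 ≤ M) :
    ‖β⁻¹ • ∑ i : MatsubaraIdx M, ((L ^ 2 : ℕ) : ℝ)⁻¹ • ∑ k : TorusSite 2 L,
        a (latticeMomentum L k 0, latticeMomentum L k 1) *
          klfb_prop f (matsubaraFreq β M i) (nambuXiCT L μ K k) *
            klfb_prop f' (matsubaraFreq β M i + q₀) (nambuXiCT L μ K (k + q))‖ ≤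
      ((2 * π) ^ 2)⁻¹ *
          (2 * Real.pi *
            (524288 / Real.pi * (ℓ + 8 * MF) *
                (Real.pi * Real.sqrt 2 / (B.Dtmin - 4 * A) * (La + A₀ * (2 / (1 / 10))) / (B.Dtmin - 4 * A) +
                  A₀ * (1 / (B.Dtmin - 4 * A) ^ 2 + Real.pi * Real.sqrt 2 * (2 + 4 * A) / (B.Dtmin - 4 * A) ^ 3)) * klScale klE0 n +
              393216 / Real.pi * (ℓ + 8 * MF) * (A₀ * (Real.pi * Real.sqrt 2 / (B.Dtmin - 4 * A))) * ((Real.pi / β) / klScale klE0 n) +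
              256 / Real.pi * Mf * (A₀ * (Real.pi * Real.sqrt 2 / (B.Dtmin - 4 * A))) *
                ((65 * ℓ' + 17408 / 3 * Mf') / klScale klE0 n ^ 2 * klScale klE0 n) *
                  (|q₀| + (4 + 8 / 3 * R.Gfr 1 * U ^ 2) * klTorusNorm L q))) +
        32 * klScale klE0 n *
            (La * (2 * Mf / klScale klE0 n) * (16 * Mf' / klScale klE0 n) +
              A₀ * ((9 * ℓf + 4 * Mf) / klScale klE0 n ^ 2 * (4 + 8 / 3 * R.Gfr 1 * U ^ 2)) * (16 * Mf' / klScale klE0 n) +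
              A₀ * (2 * Mf / klScale klE0 n) * ((65 * ℓ' + 17408 / 3 * Mf') / klScale klE0 n ^ 2 * (4 + 8 / 3 * R.Gfr 1 * U ^ 2))) / L := by
  -- frame data
  have hsm := frameShift_toLp_small hAb le_rfl
  have hA0' : 0 ≤ A := le_trans (norm_nonneg _) (hAb 0 0 (by norm_num))
  have hG0 : 0 ≤ 4 + 8 / 3 * R.Gfr 1 * U ^ 2 := by nlinarith [hR 1, sq_nonneg U]
  have hδmax0 : 0 ≤ (4 + 8 / 3 * R.Gfr 1 * U ^ 2) * klTorusNorm L q :=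
    mul_nonneg hG0 (by unfold klTorusNorm KLProgrammeLegKernels.torusSupNorm torusAbs; positivity)
  have hD2 : ∀ θ s t : ℝ, s ∈ Icc 0 (π / ‖dir θ‖) → t ∈ Icc 0 (π / ‖dir θ‖) →
      |fderiv ℝ (fun k : Fin 2 → ℝ => frameShift K (WithLp.toLp 2 k)) (s • dir θ) (dir θ) -
        fderiv ℝ (fun k : Fin 2 → ℝ => frameShift K (WithLp.toLp 2 k)) (t • dir θ) (dir θ)| ≤ 4 * A * |s - t| :=
    fun θ s t _ _ => klrk_radial_fderiv_lipschitz (contDiff_frameShift_toLp K) hsm.2.2 (norm_dir_le_one θ) s t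
  -- the shift bound with the nearest representative
  have hshift : ∀ p : ℝ × ℝ, |klbandShift μ K (klrepr L q) p - klbandPl μ K p| ≤ (4 + 8 / 3 * R.Gfr 1 * U ^ 2) * klTorusNorm L q := fun p => by
    have h := abs_klbandShift_sub_le hR hK (klrepr L q) p
    rwa [norm_klrepr_eq] at h
  -- the zone margin
  have hKb : ∀ k : Fin 2 → ℝ, |K.eval k| ≤ 1 / 20 := fun k => (abs_eval_le_of_C2 hAb k).trans hA20
  have hzone : ∀ p ∈ Icc (-π) π ×ˢ Icc (-π) π, |klbandPl μ K p| < 4 * klScale klE0 n → |p.1| ≤ π - 2 * (1 / 10) ∧ |p.2| ≤ π - 2 * (1 / 10) :=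
    fun p hp he => klbandPl_zone hμ hKb hn1 p hp he
  -- the row
  have h := klfl_lattice_soft_bubble_norm_le B (contDiff_frameShift_toLp K) (fun k _ => hsm.1 k) (fun k _ => hsm.2.1 k) hA
    (κ₂ := 4 * A) (by positivity) hD2 ha ha1 ha2 hA0 hLa
    (continuous_klbandPl μ K) (klbandPl_periodic₁ μ K) (klbandPl_periodic₂ μ K) (klbandPl_lipschitz hR hK) (μ := μ)
    (fun p _ => klbandPl_eq_klfb_band μ K p)
    (continuous_klbandShift μ K (klrepr L q)) (klbandShift_periodic₁ μ K _) (klbandShift_periodic₂ μ K _) (klbandShift_lipschitz hR hK _)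
    hδmax0 hq hshift (zm := 1 / 10) (by norm_num) hzone hlip hbd hLf hin hout hlip' hbd' hLf' hout' hMF hFlip hFbd hLF hlo hhi hq₀ hβ hn hM L
  -- the lattice values of the two bands
  have hsum : (∑ i : MatsubaraIdx M, ((L ^ 2 : ℕ) : ℝ)⁻¹ • ∑ k : TorusSite 2 L,
        a (latticeMomentum L k 0, latticeMomentum L k 1) *
          klfb_prop f (matsubaraFreq β M i) (nambuXiCT L μ K k) *
            klfb_prop f' (matsubaraFreq β M i + q₀) (nambuXiCT L μ K (k + q))) =
      ∑ i : MatsubaraIdx M, ((L ^ 2 : ℕ) : ℝ)⁻¹ • ∑ k : TorusSite 2 L,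
        a (latticeMomentum L k 0, latticeMomentum L k 1) *
          klfb_prop f (matsubaraFreq β M i) (klbandPl μ K (latticeMomentum L k 0, latticeMomentum L k 1)) *
            klfb_prop f' (matsubaraFreq β M i + q₀) (klbandShift μ K (klrepr L q) (latticeMomentum L k 0, latticeMomentum L k 1)) := by
    refine Finset.sum_congr rfl fun i _ => ?_
    congr 1
    refine Finset.sum_congr rfl fun k _ => ?_
    rw [klbandPl_latticeMomentum, klbandShift_repr_latticeMomentum]
  rw [hsum]
  exact h

/-- **THE SAME, KEYED ON THE KL REGIME**: `FrameOK R U (nScales β) μ K`, `klBetaMin ≤ β ≤ e^{c/U²}`, `0 ≤ c`, with `A := 2Gfr₀|U| + 2Gfr₁U² + Gfr₂·c/log 4`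
(`klrk_frame_C2_bound`). -/
theorem klfl_lattice_soft_bubble_norm_le_model_regime (hR : ∀ j, 0 ≤ R.Gfr j) {c β : ℝ} (hc : 0 ≤ c) (hβ : klBetaMin ≤ β)
    (hβc : β ≤ Real.exp (c / U ^ 2)) (hK : FrameOK R U (nScales β) μ K)
    (hA : 4 * (2 * R.Gfr 0 * |U| + 2 * R.Gfr 1 * U ^ 2 + R.Gfr 2 * (c / Real.log 4)) < B.Dtmin)
    (hA20 : 4 * (2 * R.Gfr 0 * |U| + 2 * R.Gfr 1 * U ^ 2 + R.Gfr 2 * (c / Real.log 4)) ≤ 1 / 20) (hμ : μ ≤ -0.15)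
    {a : ℝ × ℝ → ℂ} (ha : Continuous a) (ha1 : ∀ x y, a (x + 2 * π, y) = a (x, y)) (ha2 : ∀ x y, a (x, y + 2 * π) = a (x, y))
    {A₀ La : ℝ} (hA0 : ∀ p, ‖a p‖ ≤ A₀) (hLa : ∀ p q, ‖a p - a q‖ ≤ La * dist p q)
    {n : ℕ} (hn1 : 1 ≤ n) {L : ℕ} [NeZero L] (q : TorusSite 2 L)
    (hq : (4 + 8 / 3 * R.Gfr 1 * U ^ 2) * klTorusNorm L q ≤ klScale klE0 n / 8)
    {f f' : ℝ → ℂ} {Lf Mf ℓf Lf' Mf' ℓ' LF MF ℓ : ℝ}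
    (hlip : ∀ s s', ‖f s - f s'‖ ≤ Lf * |s - s'|) (hbd : ∀ s, ‖f s‖ ≤ Mf) (hLf : Lf ≤ ℓf / klScale klE0 n ^ 2)
    (hin : ∀ s, s ≤ (klScale klE0 n / 2) ^ 2 → f s = 0) (hout : ∀ s, (4 * klScale klE0 n) ^ 2 ≤ s → f s = 0)
    (hlip' : ∀ s s', ‖f' s - f' s'‖ ≤ Lf' * |s - s'|) (hbd' : ∀ s, ‖f' s‖ ≤ Mf') (hLf' : Lf' ≤ ℓ' / klScale klE0 n ^ 2)
    (hout' : ∀ s, (4 * klScale klE0 n) ^ 2 ≤ s → f' s = 0)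
    (hMF : 0 ≤ MF) (hFlip : ∀ s s', ‖f s * f' s - f s' * f' s'‖ ≤ LF * |s - s'|) (hFbd : ∀ s, ‖f s * f' s‖ ≤ MF)
    (hLF : LF ≤ ℓ / klScale klE0 n ^ 2)
    (hlo : a' < μ - 4 * klScale klE0 n - 4 * (2 * R.Gfr 0 * |U| + 2 * R.Gfr 1 * U ^ 2 + R.Gfr 2 * (c / Real.log 4)))
    (hhi : μ + 4 * klScale klE0 n + 4 * (2 * R.Gfr 0 * |U| + 2 * R.Gfr 1 * U ^ 2 + R.Gfr 2 * (c / Real.log 4)) < b')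
    {q₀ : ℝ} (hq₀ : |q₀| ≤ klScale klE0 n / 8) (hn : n ≤ nScales β + 1) {M : ℕ}
    (hM : β * (4 * klScale klE0 n) / (2 * Real.pi) + 1 ≤ M) :
    ‖β⁻¹ • ∑ i : MatsubaraIdx M, ((L ^ 2 : ℕ) : ℝ)⁻¹ • ∑ k : TorusSite 2 L,
        a (latticeMomentum L k 0, latticeMomentum L k 1) *
          klfb_prop f (matsubaraFreq β M i) (nambuXiCT L μ K k) *
            klfb_prop f' (matsubaraFreq β M i + q₀) (nambuXiCT L μ K (k + q))‖ ≤
      ((2 * π) ^ 2)⁻¹ *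
          (2 * Real.pi *
            (524288 / Real.pi * (ℓ + 8 * MF) *
                (Real.pi * Real.sqrt 2 / (B.Dtmin - 4 * (2 * R.Gfr 0 * |U| + 2 * R.Gfr 1 * U ^ 2 + R.Gfr 2 * (c / Real.log 4))) * (La + A₀ * (2 / (1 / 10))) /
                    (B.Dtmin - 4 * (2 * R.Gfr 0 * |U| + 2 * R.Gfr 1 * U ^ 2 + R.Gfr 2 * (c / Real.log 4))) +
                  A₀ * (1 / (B.Dtmin - 4 * (2 * R.Gfr 0 * |U| + 2 * R.Gfr 1 * U ^ 2 + R.Gfr 2 * (c / Real.log 4))) ^ 2 +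
                    Real.pi * Real.sqrt 2 * (2 + 4 * (2 * R.Gfr 0 * |U| + 2 * R.Gfr 1 * U ^ 2 + R.Gfr 2 * (c / Real.log 4))) /
                      (B.Dtmin - 4 * (2 * R.Gfr 0 * |U| + 2 * R.Gfr 1 * U ^ 2 + R.Gfr 2 * (c / Real.log 4))) ^ 3)) * klScale klE0 n +
              393216 / Real.pi * (ℓ + 8 * MF) *
                  (A₀ * (Real.pi * Real.sqrt 2 / (B.Dtmin - 4 * (2 * R.Gfr 0 * |U| + 2 * R.Gfr 1 * U ^ 2 + R.Gfr 2 * (c / Real.log 4))))) *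
                ((Real.pi / β) / klScale klE0 n) +
              256 / Real.pi * Mf * (A₀ * (Real.pi * Real.sqrt 2 / (B.Dtmin - 4 * (2 * R.Gfr 0 * |U| + 2 * R.Gfr 1 * U ^ 2 + R.Gfr 2 * (c / Real.log 4))))) *
                ((65 * ℓ' + 17408 / 3 * Mf') / klScale klE0 n ^ 2 * klScale klE0 n) *
                  (|q₀| + (4 + 8 / 3 * R.Gfr 1 * U ^ 2) * klTorusNorm L q))) +
        32 * klScale klE0 n *
            (La * (2 * Mf / klScale klE0 n) * (16 * Mf' / klScale klE0 n) +
              A₀ * ((9 * ℓf + 4 * Mf) / klScale klE0 n ^ 2 * (4 + 8 / 3 * R.Gfr 1 * U ^ 2)) * (16 * Mf' / klScale klE0 n) +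
              A₀ * (2 * Mf / klScale klE0 n) * ((65 * ℓ' + 17408 / 3 * Mf') / klScale klE0 n ^ 2 * (4 + 8 / 3 * R.Gfr 1 * U ^ 2))) / L :=
  klfl_lattice_soft_bubble_norm_le_model B hR hK (klrk_frame_C2_bound hR hc hβ hβc hK) hA hA20 hμ ha ha1 ha2 hA0 hLa hn1 q hq hlip hbd hLf hin hout
    hlip' hbd' hLf' hout' hMF hFlip hFbd hLF hlo hhi hq₀ hβ hn hM

end Model

end Summit.HubbardSuperconductivity.HubbardSuperconductivity.Theorems.KLRegimeSplit

end
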